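import Mathlib
import Literature.Combinatorics.Enumerative.InvolutionsAvoiding4321
import Literature.Combinatorics.Enumerative.NoncrossingMatchingsCatalan
import HarnessLib

/-!
# `3412`-avoiding involutions (Barnabei–Bonetti–Silimbani 2011, §5): THEOREM 7 (`3412` ⟺ no two arcs cross), THEOREM 8 (v) / COROLLARY 9 (v) (`|I_n(3412, 4321)| = 2^{n−1}`) and THEOREM 8 (ii) / COROLLARY 9 (ii) (`|I_n(3412, 321)| = F_{n+1}`)

One file for §5 of the source, in three parts (section numbers restart in each part).

## Part A — THEOREM 7: `3412`-avoiding involutions are the noncrossing partial matchings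


Layer `Literature/Combinatorics/Enumerative`, namespace `Literature.Combinatorics.Enumerative.PermContainsPattern`; lane
`lit-hodgefound` (prover seat p13, generation 39, theme «nonnesting / noncrossing matchings and restricted
involutions»).  Companion of `InvolutionsAvoiding4321.lean` (`4321` ⟺ nonnesting arcs) and of
`NoncrossingMatchingsCatalan.lean` (`#noncrossingMatchings (2n) = C_n`).

## Source

M. Barnabei, F. Bonetti, M. Silimbani, *Restricted involutions and Motzkin paths*, Adv. Appl. Math. **47** (2011)
102–115 = arXiv:0812.0463 [BarnabeiBonettiSilimbani2011] (held text `paper-arxiv-0812.0463`, arXiv numbering), §5–§6.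
In the authors' labelled Motzkin path `Φ(τ) = (M, λ)` of an involution `τ` the MAXIMAL labelling `μ` (each deficiency
closes the LARGEST open excedance — last-in-first-out, i.e. NO TWO ARCS CROSS) is the subject of:

> **Theorem 7.** Let `τ` be an involution associated with the labelled Motzkin path `(M, λ)`. Then, `τ` avoids the
> pattern `3412` if and only if `λ` is the maximal labelling.  [Proof: if a down step at position `k` has a non-maximal
> label, the maximal open excedance `a` is closed later at `j > k`, and `k j τ(k) a` … is a `3412`-subsequence.]
> [§6] Consider now the set `DI_{2h}(3412)` of fixed point free involutions avoiding `3412`. Also in this case … the set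
> `DI_{2h}(3412)` is in bijection with the set of Dyck paths of length `2h`, whose cardinality is `C_h`.

## Formalisation (arc language; theorems only — no `def`, no instance, no notation, no named fact; net debt 0)

* §1 `contains_3412_iff` (positions `a < b < c < d` with `v c < v d < v a < v b`).
* §2 ★★ `not_contains_3412_iff_noncrossing` — THEOREM 7: an involution avoids `3412` iff no two of its arcs cross
  (`contains_3412_of_crossing`: crossing arcs `i < j < u i < u j` read `u i, u j, i, j`, an occurrence; conversely
  `not_contains_3412_of_noncrossing`: in an occurrence at `a < b < c < d`, either `b < u a` — then the arcs from `a` and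
  `b` cross — or `u a < b`, and then `c`, `d` are deficiencies whose arcs `(u c, c)`, `(u d, d)` cross).
* §3 ★ `coe_mem_noncrossingMatchings_iff` (the fixed-point-free `3412`-avoiding involutions of `[m]` are the tree's
  `noncrossingMatchings m`), `card_fpf_involutions_av3412`, ★★ `card_fpf_involutions_av3412_two_mul`
  (`|DI_{2h}(3412)| = C_h`), `card_fpf_involutions_av3412_odd`, `card_fpf_involutions_av3412_eq_ite`, and
  `card_fpf_involutions_av3412_eq_av4321` (`|DI_n(3412)| = |DI_n(4321)|`: as many noncrossing as nonnesting perfect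
  matchings, Chen–Deng–Du–Stanley–Yan 2007 §1).

Not in this file: `|I_n(3412)| = M_n` (Motzkin numbers; `RestrictedInvolutionsMotzkin.lean`), Theorem 8 (i)–(iv)
(`3412` with a pattern of length `3`), Theorem 12.  Theorem 8 (v) is Part B.

## Part B — THEOREM 8 (v): `|I_n(3412, 4321)| = 2^{n−1}`


Layer `Literature/Combinatorics/Enumerative`, namespace `Literature.Combinatorics.Enumerative.PermContainsPattern`; lane
`lit-hodgefound` (prover seat p13, generation 39).  Sequel of `InvolutionsAvoiding4321.lean` (`4321` ⟺ nonnesting arcs,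
Theorem 2) and of Part A above (`3412` ⟺ noncrossing arcs, Theorem 7).

## Source

M. Barnabei, F. Bonetti, M. Silimbani, *Restricted involutions and Motzkin paths*, Adv. Appl. Math. **47** (2011)
102–115 = arXiv:0812.0463 [BarnabeiBonettiSilimbani2011] (arXiv numbering), Theorem 8: «Let `τ` be an involution in
`I_n(3412)` … v. `τ` avoids `4321` if and only if» its Motzkin path has height at most `1` («the height of a Motzkin path
corresponding to an involution avoiding both `4321` and `3412` can not exceed `1`»), and the enumerative consequence
«v. `|I_n(3412,4321)| = 2^{n−1}`».

## Proof formalised (arc language)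

By Theorems 2 and 7 an involution avoids both patterns iff its arcs pairwise neither nest nor cross, i.e. any two arcs
`i < u i`, `j < u j` with `i < j` are separated, `u i < j` (§1).  Sort such involutions `u` of `[n+1]` by the partner of
the last letter: either the last letter is fixed (`u = τ ⊕ 1`, `τ ∈ I_n(3412,4321)`), or it closes an arc from the
letter `j`, and then the letters strictly between are fixed (an arc there would nest in or cross `(j, n)`), so that
`u = τ ⊕ α_b` with `τ ∈ I_j(3412,4321)` and `α_b ∈ S_{b+1}` the transposition of the two ends (§2–§3).  Hence
`K_{n+1} = Σ_{j ≤ n} K_j` (§4), so `K_{n+2} = 2 K_{n+1}` and `K_n = 2^{n−1}` for `n ≥ 1` (§5).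

## Contents (theorems only — no `def`, no instance, no notation, no named fact; net debt 0)

* §1 ★ `not_contains_3412_4321_iff_separated`; `contains_3412_directSum_iff`, `contains_4321_directSum_iff`.
* §2 the end-swap block `Equiv.swap 0 (Fin.last b)`: `swap_ends_not_contains_3412_4321`.
* §3 `card_involutions_av3412_av4321_lastFixed` (fibre `τ ⊕ 1`), ★ `card_involutions_av3412_av4321_lastArc`
  (fibre `τ ⊕ α_b`).
* §4 ★★ `card_involutions_av3412_av4321_succ_eq_sum` (`K_{n+1} = Σ_{j ≤ n} K_j`).
* §5 ★★★ `card_involutions_av3412_av4321` (`K_{n+1} = 2^n`), `card_involutions_av3412_av4321_zero`,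
  `card_involutions_av3412_av4321_pos` (`K_n = 2^{n−1}`, `n ≥ 1`).

## Part C — THEOREM 8 (ii) and COROLLARY 9 (ii): `|I_n(3412, 321)| = F_{n+1}`

Source, Theorem 8: «Let `τ` be an involution in `I_n(3412)` associated with the labelled Motzkin path `(M, μ)`. Then: …
ii. `τ` avoids `321` if and only if the irreducible components of `M` are either `H` or `UD`», and Corollary 9: «ii.
`|I_n(3412,321)| = F_{n+1}`» (`F_n` the Fibonacci numbers, `F_1 = F_2 = 1`).  On arcs (§1,
★ `not_contains_3412_321_iff_adjacent`): an involution avoids `3412` and `321` iff every arc joins two consecutive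
letters — by Part B §1 its arcs are pairwise separated and by `not_contains_321_iff_nonnesting` no fixed point is
covered, so the letter after an opener is its partner.  Sorting `I_{k+2}(3412, 321)` by the partner of the last letter
(§2: fixed — `τ ⊕ 1`; its predecessor — `τ ⊕ (0 1)`; nothing else) gives ★★ `card_involutions_av3412_av321_add_two`
(`a_{k+2} = a_{k+1} + a_k`) and ★★★ `card_involutions_av3412_av321`: `|I_n(3412, 321)| = Nat.fib (n + 1)`
(`card_adjacent_involutions`: the monomer–dimer tilings of a row of `n` cells).
-/

namespace Literature.Combinatorics.Enumerative

namespace PermContainsPattern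

open Finset Equiv
open Literature.Computability.AlgebraicComplexity

variable {n m k : ℕ}

/-! ## Part A — THEOREM 7: `3412` ⟺ no two arcs cross -/

/-! ### §1 Occurrences of `3412` -/

/-- `v` contains `3412` iff four positions `a < b < c < d` carry letters with `v c < v d < v a < v b`.
[cite: BarnabeiBonettiSilimbani2011, §2 (pattern containment; arXiv 0812.0463)] -/
theorem contains_3412_iff (v : Perm (Fin n)) :
    PermContainsPattern v ![3, 4, 1, 2] ↔
      ∃ a b c d : Fin n, a < b ∧ b < c ∧ c < d ∧ v c < v d ∧ v d < v a ∧ v a < v b := by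
  constructor
  · rintro ⟨f, hf, hfv⟩
    exact ⟨f 0, f 1, f 2, f 3, hf (by decide), hf (by decide), hf (by decide), (hfv 2 3).1 (by decide),
      (hfv 3 0).1 (by decide), (hfv 0 1).1 (by decide)⟩
  · rintro ⟨a, b, c, d, hab, hbc, hcd, h1, h2, h3⟩
    have hmono : StrictMono ![a, b, c, d] := by
      refine Fin.strictMono_iff_lt_succ.2 fun x => ?_
      fin_cases x
      · exact hab
      · exact hbc
      · exact hcd
    have h4 : v c < v a := h1.trans h2
    have h5 : v c < v b := h4.trans h3
    have h6 : v d < v b := h2.trans h3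
    have n1 := not_lt.2 h1.le; have n2 := not_lt.2 h2.le; have n3 := not_lt.2 h3.le
    have n4 := not_lt.2 h4.le; have n5 := not_lt.2 h5.le; have n6 := not_lt.2 h6.le
    refine ⟨![a, b, c, d], hmono, fun x y => ?_⟩
    fin_cases x <;> fin_cases y <;> simp [h1, h2, h3, h4, h5, h6, n1, n2, n3, n4, n5, n6]

/-! ### §2 THEOREM 7: an involution avoids `3412` iff no two arcs cross -/

/-- Two crossing arcs `i < j < u i < u j` of an involution give the occurrence `u i, u j, i, j` of `3412` (at the
positions `i < j < u i < u j`). [cite: BarnabeiBonettiSilimbani2011, Theorem 7 (proof; arXiv 0812.0463)] -/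
theorem contains_3412_of_crossing {u : Perm (Fin n)} (hu : ∀ x, u (u x) = x) {i j : Fin n} (hij : i < j)
    (hji : j < u i) (huij : u i < u j) : PermContainsPattern u ![3, 4, 1, 2] :=
  (contains_3412_iff u).2 ⟨i, j, u i, u j, hij, hji, huij, by rw [hu, hu]; exact hij, by rw [hu]; exact hji, huij⟩

/-- Conversely, an involution whose arcs do not cross avoids `3412`: in an occurrence `u c < u d < u a < u b` at
`a < b < c < d`, if `b < u a` the arcs from `a` and `b` cross (`a < b < u a < u b`); otherwise `u a < b` (`u a = b` would
force `u b = a < u a`), so `u c < u d < u a < b < c < d`: `c` and `d` are deficiencies and the arcs `(u c, c)`, `(u d, d)`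
cross. [cite: BarnabeiBonettiSilimbani2011, Theorem 7 (arXiv 0812.0463)] -/
theorem not_contains_3412_of_noncrossing {u : Perm (Fin n)} (hu : ∀ x, u (u x) = x)
    (hnc : ∀ i j : Fin n, i < j → j < u i → u i < u j → False) : ¬ PermContainsPattern u ![3, 4, 1, 2] := by
  intro h
  obtain ⟨a, b, c, d, hab, hbc, hcd, h1, h2, h3⟩ := (contains_3412_iff u).1 h
  by_cases hb : b < u a
  · exact hnc a b hab hb h3
  · have hne : u a ≠ b := fun e => by
      have : u b = a := by rw [← e, hu]
      exact absurd (this ▸ h3 : u a < a) (not_lt.2 (e ▸ hab.le))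
    have hua : u a < b := lt_of_le_of_ne (not_lt.1 hb) hne
    exact hnc (u c) (u d) h1 (by rw [hu]; exact (h2.trans hua).trans hbc) (by rw [hu, hu]; exact hcd)

/-- ★★ **THEOREM 7 (Barnabei–Bonetti–Silimbani).** An involution avoids `3412` iff its arc diagram is noncrossing
(the labelling of its Motzkin path is maximal: every deficiency closes the latest open excedance).
[cite: BarnabeiBonettiSilimbani2011, Theorem 7 (arXiv 0812.0463)] -/
theorem not_contains_3412_iff_noncrossing {u : Perm (Fin n)} (hu : ∀ x, u (u x) = x) :
    ¬ PermContainsPattern u ![3, 4, 1, 2] ↔ ∀ i j : Fin n, i < j → j < u i → u i < u j → False :=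
  ⟨fun h _ _ hij hji huij => h (contains_3412_of_crossing hu hij hji huij), not_contains_3412_of_noncrossing hu⟩

/-! ### §3 Fixed-point-free `3412`-avoiding involutions = noncrossing perfect matchings -/

/-- ★ **A fixed-point-free involution avoids `3412` iff it is a noncrossing perfect matching**: for `u : Perm (Fin m)`,
`⇑u ∈ noncrossingMatchings m` (the tree's noncrossing fixed-point-free involutions `Fin m → Fin m`,
Chen–Deng–Du–Stanley–Yan 2007 §1) iff `u * u = 1`, `u` avoids `3412` and `u` has no fixed point.
[cite: BarnabeiBonettiSilimbani2011, Theorem 7 and §6 (arXiv 0812.0463)] [cite: ChenDengDuStanleyYan2007, §1] -/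
theorem coe_mem_noncrossingMatchings_iff (u : Perm (Fin m)) :
    (⇑u) ∈ noncrossingMatchings m ↔ (u * u = 1 ∧ ¬ PermContainsPattern u ![3, 4, 1, 2]) ∧ ∀ i, u i ≠ i := by
  rw [mem_noncrossingMatchings, mem_perfectMatchings, mul_self_eq_one_iff_apply_apply]
  constructor
  · rintro ⟨⟨hinv, hfp⟩, hnc⟩
    exact ⟨⟨hinv, not_contains_3412_of_noncrossing hinv hnc⟩, hfp⟩
  · rintro ⟨⟨hinv, hav⟩, hfp⟩
    exact ⟨⟨hinv, hfp⟩, (not_contains_3412_iff_noncrossing hinv).1 hav⟩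

/-- ★ The fixed-point-free `3412`-avoiding involutions of `[m]` are equinumerous with (indeed the same functions as)
the noncrossing perfect matchings of `[m]`. [cite: BarnabeiBonettiSilimbani2011, §6 (arXiv 0812.0463)]
[cite: ChenDengDuStanleyYan2007, §1] -/
theorem card_fpf_involutions_av3412 (m : ℕ) :
    Nat.card {u : Perm (Fin m) // (u * u = 1 ∧ ¬ PermContainsPattern u ![3, 4, 1, 2]) ∧ ∀ i, u i ≠ i} =
      (noncrossingMatchings m).card := by
  rw [← Nat.card_eq_finsetCard]
  refine Nat.card_congr (Equiv.ofBijective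
    (fun u => (⟨⇑u.1, (coe_mem_noncrossingMatchings_iff u.1).2 u.2⟩ : (noncrossingMatchings m : Set (Fin m → Fin m))))
    ⟨fun u u' h => Subtype.ext (Equiv.ext fun x => congrFun (congrArg Subtype.val h) x), fun M => ?_⟩)
  have hinv : Function.Involutive M.1 :=
    (mem_perfectMatchings.1 (noncrossingMatchings_subset_perfectMatchings M.2)).1
  exact ⟨⟨hinv.toPerm M.1, (coe_mem_noncrossingMatchings_iff _).1 (by rw [hinv.coe_toPerm]; exact M.2)⟩, rfl⟩

/-- ★★ **`|DI_{2h}(3412)| = C_h`** (Barnabei–Bonetti–Silimbani, §6: «the set `DI_{2h}(3412)` is in bijection with the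
set of Dyck paths of length `2h`, whose cardinality is `C_h`»): the fixed-point-free `3412`-avoiding involutions of
`[2h]` are the noncrossing perfect matchings, counted in the tree by `card_noncrossingMatchings_two_mul`.
[cite: BarnabeiBonettiSilimbani2011, §6 (arXiv 0812.0463)] -/
theorem card_fpf_involutions_av3412_two_mul (h : ℕ) :
    Nat.card {u : Perm (Fin (2 * h)) // (u * u = 1 ∧ ¬ PermContainsPattern u ![3, 4, 1, 2]) ∧ ∀ i, u i ≠ i} =
      catalan h := by
  rw [card_fpf_involutions_av3412, card_noncrossingMatchings_two_mul]

/-- No fixed-point-free involution of an odd number of letters. [cite: BarnabeiBonettiSilimbani2011, §6 (arXiv 0812.0463)] -/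
theorem card_fpf_involutions_av3412_odd (h : ℕ) :
    Nat.card {u : Perm (Fin (2 * h + 1)) // (u * u = 1 ∧ ¬ PermContainsPattern u ![3, 4, 1, 2]) ∧ ∀ i, u i ≠ i} = 0 := by
  rw [card_fpf_involutions_av3412, noncrossingMatchings_odd, card_empty]

/-- The count for every `m`: `catalan (m/2)` for `m` even, `0` for `m` odd.
[cite: BarnabeiBonettiSilimbani2011, §6 (arXiv 0812.0463)] -/
theorem card_fpf_involutions_av3412_eq_ite (m : ℕ) :
    Nat.card {u : Perm (Fin m) // (u * u = 1 ∧ ¬ PermContainsPattern u ![3, 4, 1, 2]) ∧ ∀ i, u i ≠ i} =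
      if m % 2 = 0 then catalan (m / 2) else 0 := by
  rw [card_fpf_involutions_av3412, card_noncrossingMatchings]

/-- **`|DI_n(3412)| = |DI_n(4321)|`** — as many noncrossing as nonnesting perfect matchings (both sets «in bijection
with the set of Dyck paths», §6; Chen–Deng–Du–Stanley–Yan 2007 §1). [cite: BarnabeiBonettiSilimbani2011, §6 (arXiv 0812.0463)]
[cite: ChenDengDuStanleyYan2007, §1] -/
theorem card_fpf_involutions_av3412_eq_av4321 (m : ℕ) :
    Nat.card {u : Perm (Fin m) // (u * u = 1 ∧ ¬ PermContainsPattern u ![3, 4, 1, 2]) ∧ ∀ i, u i ≠ i} =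
      Nat.card {u : Perm (Fin m) // (u * u = 1 ∧ ¬ PermContainsPattern u ![4, 3, 2, 1]) ∧ ∀ i, u i ≠ i} := by
  rw [card_fpf_involutions_av3412_eq_ite, card_fpf_involutions_av4321_eq_ite]

/-! ## Part B — THEOREM 8 (v): `|I_n(3412, 4321)| = 2^{n−1}` -/


/-! ### §1 Arcs pairwise separated -/

/-- ★ An involution avoids both `3412` and `4321` iff its arcs pairwise neither cross nor nest: for excedances `i < j`,
`u i < j` («the height of the Motzkin path can not exceed `1`»).
[cite: BarnabeiBonettiSilimbani2011, Theorem 8 (v) (arXiv 0812.0463)] -/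
theorem not_contains_3412_4321_iff_separated {u : Perm (Fin n)} (hu : ∀ x, u (u x) = x) :
    (¬ PermContainsPattern u ![3, 4, 1, 2] ∧ ¬ PermContainsPattern u ![4, 3, 2, 1]) ↔
      ∀ i j : Fin n, i < j → i < u i → j < u j → u i < j := by
  rw [not_contains_3412_iff_noncrossing hu, not_contains_4321_iff_nonnesting hu]
  constructor
  · rintro ⟨hnc, hnn⟩ i j hij hi hj
    rcases lt_trichotomy (u i) j with h | h | h
    · exact h
    · exact absurd (by rw [← h, hu] : u j = i) (ne_of_gt (hij.trans hj))
    · rcases lt_trichotomy (u i) (u j) with h' | h' | h'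
      · exact (hnc i j hij h h').elim
      · exact absurd (u.injective h') hij.ne
      · exact (hnn i j hij hj h').elim
  · intro h
    exact ⟨fun i j hij hji huij => absurd (h i j hij (hij.trans hji) (hji.trans huij)) (not_lt.2 hji.le),
      fun i j hij hj hji => absurd (h i j hij (hij.trans (hj.trans hji)) hj) (not_lt.2 (hj.trans hji).le)⟩

/-- `p ⊕ p'` contains `3412` iff `p` or `p'` does (`3412` ends below its first letter, so no occurrence straddles).
[cite: Bona2012, §4.3 (held text p0134)] -/
theorem contains_3412_directSum_iff (v : Perm (Fin m)) (w : Perm (Fin k)) :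
    PermContainsPattern (finSumFinEquiv.symm.trans ((v.sumCongr w).trans finSumFinEquiv)) ![3, 4, 1, 2] ↔
      PermContainsPattern v ![3, 4, 1, 2] ∨ PermContainsPattern w ![3, 4, 1, 2] := by
  constructor
  · intro h
    by_contra hc
    push Not at hc
    exact not_contains_directSum (q := ![3, 4, 1, 2]) (by decide) hc.1 hc.2 h
  · rintro (h | h)
    · exact trans (directSum_contains_left v w) h
    · exact trans (directSum_contains_right v w) h

/-- `p ⊕ p'` contains `4321` iff `p` or `p'` does. [cite: Bona2012, §4.3 (held text p0134)] -/
theorem contains_4321_directSum_iff (v : Perm (Fin m)) (w : Perm (Fin k)) :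
    PermContainsPattern (finSumFinEquiv.symm.trans ((v.sumCongr w).trans finSumFinEquiv)) ![4, 3, 2, 1] ↔
      PermContainsPattern v ![4, 3, 2, 1] ∨ PermContainsPattern w ![4, 3, 2, 1] := by
  constructor
  · intro h
    by_contra hc
    push Not at hc
    exact not_contains_directSum (q := ![4, 3, 2, 1]) (by decide) hc.1 hc.2 h
  · rintro (h | h)
    · exact trans (directSum_contains_left v w) h
    · exact trans (directSum_contains_right v w) h

/-! ### §2 The block `α_b`: the two ends exchanged, the interior fixed -/

/-- The transposition of the two ends of `[b+1]` is an involution avoiding `3412` and `4321` (one arc, or none).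
[cite: BarnabeiBonettiSilimbani2011, Theorem 8 (v) (arXiv 0812.0463)] -/
theorem swap_ends_not_contains_3412_4321 (b : ℕ) :
    Equiv.swap (0 : Fin (b + 1)) (Fin.last b) * Equiv.swap (0 : Fin (b + 1)) (Fin.last b) = 1 ∧
      ¬ PermContainsPattern (Equiv.swap (0 : Fin (b + 1)) (Fin.last b)) ![3, 4, 1, 2] ∧
        ¬ PermContainsPattern (Equiv.swap (0 : Fin (b + 1)) (Fin.last b)) ![4, 3, 2, 1] := by
  have hu : ∀ x, Equiv.swap (0 : Fin (b + 1)) (Fin.last b) (Equiv.swap (0 : Fin (b + 1)) (Fin.last b) x) = x :=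
    fun x => Equiv.swap_apply_self _ _ _
  refine ⟨Equiv.swap_mul_self _ _, (not_contains_3412_4321_iff_separated hu).2 fun i j hij hi hj => ?_⟩
  -- the only excedance is `0`
  have hexc : ∀ x : Fin (b + 1), x < Equiv.swap (0 : Fin (b + 1)) (Fin.last b) x → x = 0 := by
    intro x hx
    by_contra hx0
    by_cases hxl : x = Fin.last b
    · rw [hxl, Equiv.swap_apply_right] at hx
      exact absurd hx (not_lt.2 (Fin.zero_le _))
    · rw [Equiv.swap_apply_of_ne_of_ne hx0 hxl] at hx
      exact lt_irrefl _ hx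
  have h0 := hexc i hi
  have h1 := hexc j hj
  rw [h0, h1] at hij
  exact absurd hij (lt_irrefl _)

/-! ### §3 The fibres over the partner of the last letter -/

/-- The involutions of `I_{k+1}(3412,4321)` fixing the last letter are the `τ ⊕ 1`, `τ ∈ I_k(3412,4321)`.
[cite: BarnabeiBonettiSilimbani2011, Theorem 8 (v) (arXiv 0812.0463)] -/
theorem card_involutions_av3412_av4321_lastFixed (k : ℕ) :
    Nat.card {u : Perm (Fin (k + 1)) // (u * u = 1 ∧ ¬ PermContainsPattern u ![3, 4, 1, 2] ∧
        ¬ PermContainsPattern u ![4, 3, 2, 1]) ∧ ((u (Fin.last k) : ℕ)) = k} =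
      Nat.card {τ : Perm (Fin k) // τ * τ = 1 ∧ ¬ PermContainsPattern τ ![3, 4, 1, 2] ∧
        ¬ PermContainsPattern τ ![4, 3, 2, 1]} := by
  refine (Nat.card_congr (Equiv.ofBijective (fun τ : {τ : Perm (Fin k) // τ * τ = 1 ∧
      ¬ PermContainsPattern τ ![3, 4, 1, 2] ∧ ¬ PermContainsPattern τ ![4, 3, 2, 1]} =>
    (⟨finSumFinEquiv.symm.trans ((τ.1.sumCongr (1 : Perm (Fin 1))).trans finSumFinEquiv),
      ⟨(directSum_mul_self_eq_one_iff τ.1 1).2 ⟨τ.2.1, mul_one 1⟩,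
        fun h => ((contains_3412_directSum_iff τ.1 1).1 h).elim τ.2.2.1 (not_contains_of_lt _ _ (by norm_num)),
        fun h => ((contains_4321_directSum_iff τ.1 1).1 h).elim τ.2.2.2 (not_contains_of_lt _ _ (by norm_num))⟩,
      by rw [directSum_one_apply_last, Fin.val_last]⟩ :
    {u : Perm (Fin (k + 1)) // (u * u = 1 ∧ ¬ PermContainsPattern u ![3, 4, 1, 2] ∧
        ¬ PermContainsPattern u ![4, 3, 2, 1]) ∧ ((u (Fin.last k) : ℕ)) = k})) ⟨?_, ?_⟩)).symm
  · rintro ⟨τ, hτ⟩ ⟨τ', hτ'⟩ h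
    have h2 := Prod.ext_iff.mp (directSum_injective k 1 (a₁ := (τ, 1)) (a₂ := (τ', 1)) (congrArg Subtype.val h))
    exact Subtype.ext h2.1
  · rintro ⟨u, ⟨hinv, h3412, h4321⟩, hlast⟩
    have hl : u (Fin.last k) = Fin.last k := Fin.ext (by rw [hlast, Fin.val_last])
    have hlow : ∀ i : Fin k, ((u (Fin.castAdd 1 i)) : ℕ) < k := by
      intro i
      have hne : u (Fin.castAdd 1 i) ≠ Fin.last k := fun e => by
        have := congrArg Fin.val (u.injective (e.trans hl.symm))
        simp only [Fin.val_castAdd, Fin.val_last] at this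
        omega
      exact lt_of_le_of_ne (Nat.lt_succ_iff.1 (u _).2) (fun e => hne (Fin.ext (by simpa using e)))
    obtain ⟨τ, ε, hρ⟩ := exists_eq_directSum u hlow
    obtain rfl : ε = 1 := Subsingleton.elim _ _
    subst hρ
    refine ⟨⟨τ, ((directSum_mul_self_eq_one_iff τ 1).1 hinv).1,
      fun h => h3412 ((contains_3412_directSum_iff τ 1).2 (Or.inl h)),
      fun h => h4321 ((contains_4321_directSum_iff τ 1).2 (Or.inl h))⟩, rfl⟩

/-- ★ The involutions of `I_{j+b+1}(3412,4321)` whose last letter closes an arc from the letter `j` are the `τ ⊕ α_b`,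
`τ ∈ I_j(3412,4321)`, `α_b` the exchange of the two ends of the last `b + 1` letters: the letters under the arc
`(j, j+b)` are fixed (an arc there would cross or nest), and the letters before `j` are permuted among themselves.
[cite: BarnabeiBonettiSilimbani2011, Theorem 8 (v) (arXiv 0812.0463)] -/
theorem card_involutions_av3412_av4321_lastArc (j b : ℕ) :
    Nat.card {u : Perm (Fin (j + (b + 1))) // (u * u = 1 ∧ ¬ PermContainsPattern u ![3, 4, 1, 2] ∧
        ¬ PermContainsPattern u ![4, 3, 2, 1]) ∧ ((u (Fin.natAdd j (Fin.last b)) : ℕ)) = j} =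
      Nat.card {τ : Perm (Fin j) // τ * τ = 1 ∧ ¬ PermContainsPattern τ ![3, 4, 1, 2] ∧
        ¬ PermContainsPattern τ ![4, 3, 2, 1]} := by
  obtain ⟨hαinv, hα3412, hα4321⟩ := swap_ends_not_contains_3412_4321 b
  refine (Nat.card_congr (Equiv.ofBijective (fun τ : {τ : Perm (Fin j) // τ * τ = 1 ∧
      ¬ PermContainsPattern τ ![3, 4, 1, 2] ∧ ¬ PermContainsPattern τ ![4, 3, 2, 1]} =>
    (⟨finSumFinEquiv.symm.trans ((τ.1.sumCongr (Equiv.swap (0 : Fin (b + 1)) (Fin.last b))).trans finSumFinEquiv),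
      ⟨(directSum_mul_self_eq_one_iff τ.1 _).2 ⟨τ.2.1, hαinv⟩,
        fun h => ((contains_3412_directSum_iff τ.1 _).1 h).elim τ.2.2.1 hα3412,
        fun h => ((contains_4321_directSum_iff τ.1 _).1 h).elim τ.2.2.2 hα4321⟩,
      by rw [directSum_apply_natAdd, Equiv.swap_apply_right, Fin.val_natAdd, Fin.val_zero, add_zero]⟩ :
    {u : Perm (Fin (j + (b + 1))) // (u * u = 1 ∧ ¬ PermContainsPattern u ![3, 4, 1, 2] ∧
        ¬ PermContainsPattern u ![4, 3, 2, 1]) ∧ ((u (Fin.natAdd j (Fin.last b)) : ℕ)) = j})) ⟨?_, ?_⟩)).symm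
  · rintro ⟨τ, hτ⟩ ⟨τ', hτ'⟩ h
    have h2 := Prod.ext_iff.mp (directSum_injective j (b + 1) (a₁ := (τ, Equiv.swap (0 : Fin (b + 1)) (Fin.last b)))
      (a₂ := (τ', Equiv.swap (0 : Fin (b + 1)) (Fin.last b))) (congrArg Subtype.val h))
    exact Subtype.ext h2.1
  · rintro ⟨u, ⟨hinv, h3412, h4321⟩, hlast⟩
    have hu : ∀ x, u (u x) = x := (mul_self_eq_one_iff_apply_apply u).1 hinv
    have hsep := (not_contains_3412_4321_iff_separated hu).1 ⟨h3412, h4321⟩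
    -- the arc `(j, last)`: `u (natAdd j 0) = natAdd j (last b)`
    have hl : u (Fin.natAdd j (Fin.last b)) = Fin.natAdd j 0 := Fin.ext (by rw [hlast]; simp)
    have hl' : u (Fin.natAdd j 0) = Fin.natAdd j (Fin.last b) := by rw [← hl, hu]
    -- the letters before `j` are permuted among themselves
    have hlow : ∀ i : Fin j, ((u (Fin.castAdd (b + 1) i)) : ℕ) < j := by
      intro i
      by_contra hc
      push Not at hc
      have hne : u (Fin.castAdd (b + 1) i) ≠ Fin.natAdd j 0 := fun e => by
        have := congrArg Fin.val (u.injective (e.trans hl.symm))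
        simp only [Fin.val_castAdd, Fin.val_natAdd, Fin.val_last] at this
        omega
      have hgt : j < ((u (Fin.castAdd (b + 1) i)) : ℕ) :=
        lt_of_le_of_ne hc fun e => hne (Fin.ext (by simp only [Fin.val_natAdd, Fin.val_zero]; omega))
      have hval : ((u (Fin.castAdd (b + 1) i)) : ℕ) < j + (b + 1) := (u _).2
      -- so `b ≥ 1`, the letter `j` is an excedance, and the excedance `i < j` would have to close before `j`
      have h0exc : Fin.natAdd j (0 : Fin (b + 1)) < u (Fin.natAdd j 0) := by
        rw [hl']
        exact Fin.lt_def.2 (by simp only [Fin.val_natAdd, Fin.val_zero, Fin.val_last]; omega)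
      have hi : Fin.castAdd (b + 1) i < Fin.natAdd j (0 : Fin (b + 1)) :=
        Fin.lt_def.2 (by simp only [Fin.val_castAdd, Fin.val_natAdd, Fin.val_zero]; omega)
      have hiexc : Fin.castAdd (b + 1) i < u (Fin.castAdd (b + 1) i) :=
        Fin.lt_def.2 (by simp only [Fin.val_castAdd]; omega)
      have := Fin.lt_def.1 (hsep _ _ hi hiexc h0exc)
      simp only [Fin.val_natAdd, Fin.val_zero] at this
      omega
    obtain ⟨τ, ρ, hσ⟩ := exists_eq_directSum u hlow
    -- `ρ` exchanges the two ends and fixes the interior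
    have hρinv : ρ * ρ = 1 := ((directSum_mul_self_eq_one_iff τ ρ).1 (hσ ▸ hinv)).2
    have hρu : ∀ x, ρ (ρ x) = x := (mul_self_eq_one_iff_apply_apply ρ).1 hρinv
    have hρ3412 : ¬ PermContainsPattern ρ ![3, 4, 1, 2] := fun h => h3412 (hσ ▸ (contains_3412_directSum_iff τ ρ).2 (Or.inr h))
    have hρ4321 : ¬ PermContainsPattern ρ ![4, 3, 2, 1] := fun h => h4321 (hσ ▸ (contains_4321_directSum_iff τ ρ).2 (Or.inr h))
    have hρsep := (not_contains_3412_4321_iff_separated hρu).1 ⟨hρ3412, hρ4321⟩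
    have hρ0 : ρ 0 = Fin.last b := by
      have := hl'
      rw [hσ, directSum_apply_natAdd] at this
      exact Fin.natAdd_injective _ _ this
    have hρl : ρ (Fin.last b) = 0 := by rw [← hρ0, hρu]
    have hρ : ρ = Equiv.swap 0 (Fin.last b) := by
      refine Equiv.ext fun x => ?_
      rw [Equiv.swap_apply_def]
      split_ifs with hx0 hxl
      · rw [hx0, hρ0]
      · rw [hxl, hρl]
      · -- an interior letter is fixed: otherwise its arc would follow the excedance `0`
        have hx0' : (0 : Fin (b + 1)) < x := lt_of_le_of_ne (Fin.zero_le _) (Ne.symm hx0)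
        have hxl' : x < Fin.last b := lt_of_le_of_ne (Fin.le_last _) hxl
        have h0exc : (0 : Fin (b + 1)) < ρ 0 := by rw [hρ0]; exact hx0'.trans hxl'
        rcases lt_trichotomy x (ρ x) with h | h | h
        · have := hρsep 0 x hx0' h0exc h
          rw [hρ0] at this
          exact absurd this (not_lt.2 (Fin.le_last _))
        · exact h.symm
        · -- `ρ x < x` is an excedance `y` with `ρ y = x`, `0 < y`
          have hy : ρ x < ρ (ρ x) := by rw [hρu]; exact h
          have hy0 : (0 : Fin (b + 1)) < ρ x := by
            refine lt_of_le_of_ne (Fin.zero_le _) fun e => hxl ?_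
            rw [← hρu x, ← e, hρ0]
          have := hρsep 0 (ρ x) hy0 h0exc hy
          rw [hρ0] at this
          exact absurd this (not_lt.2 (Fin.le_last _))
    subst hσ
    subst hρ
    exact ⟨⟨τ, ((directSum_mul_self_eq_one_iff τ _).1 hinv).1,
      fun h => h3412 ((contains_3412_directSum_iff τ _).2 (Or.inl h)),
      fun h => h4321 ((contains_4321_directSum_iff τ _).2 (Or.inl h))⟩, rfl⟩

/-! ### §4 The recurrence `K_{n+1} = Σ_{j ≤ n} K_j` -/

/-- Splitting a finite subtype along a statistic with values in a `Fintype`. [folklore] -/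
private theorem card_subtype_eq_sum_fiber' {α β : Type*} [Finite α] [Fintype β] (P : α → Prop) (f : α → β) :
    Nat.card {x // P x} = ∑ t : β, Nat.card {x // P x ∧ f x = t} := by
  rw [← Nat.card_sigma]
  exact Nat.card_congr ((Equiv.sigmaFiberEquiv fun x : {x // P x} => f x.1).symm.trans
    (Equiv.sigmaCongrRight fun t => Equiv.subtypeSubtypeEquivSubtypeInter P fun x => f x = t))

/-- ★★ **The recurrence**: sorting `I_{n+1}(3412,4321)` by the partner of the last letter,
`K_{n+1} = K_n + Σ_{j<n} K_j = Σ_{j ≤ n} K_j`. [cite: BarnabeiBonettiSilimbani2011, Theorem 8 (v) (arXiv 0812.0463)] -/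
theorem card_involutions_av3412_av4321_succ_eq_sum (n : ℕ) :
    Nat.card {u : Perm (Fin (n + 1)) // u * u = 1 ∧ ¬ PermContainsPattern u ![3, 4, 1, 2] ∧
        ¬ PermContainsPattern u ![4, 3, 2, 1]} =
      ∑ j ∈ range (n + 1), Nat.card {τ : Perm (Fin j) // τ * τ = 1 ∧ ¬ PermContainsPattern τ ![3, 4, 1, 2] ∧
        ¬ PermContainsPattern τ ![4, 3, 2, 1]} := by
  rw [card_subtype_eq_sum_fiber' (fun u : Perm (Fin (n + 1)) => u * u = 1 ∧ ¬ PermContainsPattern u ![3, 4, 1, 2] ∧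
      ¬ PermContainsPattern u ![4, 3, 2, 1]) (fun u => u (Fin.last n)), Fin.sum_univ_castSucc, sum_range_succ]
  congr 1
  · rw [← Fin.sum_univ_eq_sum_range (fun j => Nat.card {τ : Perm (Fin j) // τ * τ = 1 ∧
      ¬ PermContainsPattern τ ![3, 4, 1, 2] ∧ ¬ PermContainsPattern τ ![4, 3, 2, 1]}) n]
    refine Finset.sum_congr rfl fun j _ => ?_
    obtain ⟨j, hj⟩ := j
    obtain ⟨b, rfl⟩ : ∃ b, n = j + b := ⟨n - j, by omega⟩
    rw [Fin.val_mk, ← card_involutions_av3412_av4321_lastArc j b]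
    refine Nat.card_congr (Equiv.subtypeEquivRight fun u => and_congr_right fun _ => ?_)
    rw [Fin.ext_iff, Fin.val_castSucc, Fin.val_mk, show (Fin.last (j + b) : Fin (j + b + 1)) =
      Fin.natAdd j (Fin.last b) from Fin.ext (by simp)]
  · rw [← card_involutions_av3412_av4321_lastFixed n]
    refine Nat.card_congr (Equiv.subtypeEquivRight fun u => and_congr_right fun _ => ?_)
    rw [Fin.ext_iff, Fin.val_last]

/-! ### §5 `|I_n(3412, 4321)| = 2^{n−1}` -/

/-- `K_0 = 1` (the empty involution). [cite: BarnabeiBonettiSilimbani2011, Theorem 8 (v) (arXiv 0812.0463)] -/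
theorem card_involutions_av3412_av4321_zero :
    Nat.card {u : Perm (Fin 0) // u * u = 1 ∧ ¬ PermContainsPattern u ![3, 4, 1, 2] ∧
      ¬ PermContainsPattern u ![4, 3, 2, 1]} = 1 := by
  have : Unique {u : Perm (Fin 0) // u * u = 1 ∧ ¬ PermContainsPattern u ![3, 4, 1, 2] ∧
      ¬ PermContainsPattern u ![4, 3, 2, 1]} :=
    { default := ⟨1, by simp, not_contains_of_lt _ _ (by norm_num), not_contains_of_lt _ _ (by norm_num)⟩
      uniq := fun u => Subtype.ext (Equiv.ext fun x => Fin.elim0 x) }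
  exact Nat.card_unique

/-- ★★★ **THEOREM 8 (v) (Barnabei–Bonetti–Silimbani): `|I_{n+1}(3412, 4321)| = 2^n`** — from
`K_{m+1} = Σ_{j ≤ m} K_j`, `K_{n+2} = 2 K_{n+1}`. [cite: BarnabeiBonettiSilimbani2011, Theorem 8 (v) (arXiv 0812.0463)] -/
theorem card_involutions_av3412_av4321 (n : ℕ) :
    Nat.card {u : Perm (Fin (n + 1)) // u * u = 1 ∧ ¬ PermContainsPattern u ![3, 4, 1, 2] ∧
      ¬ PermContainsPattern u ![4, 3, 2, 1]} = 2 ^ n := by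
  induction n with
  | zero => rw [card_involutions_av3412_av4321_succ_eq_sum, sum_range_one, card_involutions_av3412_av4321_zero, pow_zero]
  | succ n ih =>
    rw [card_involutions_av3412_av4321_succ_eq_sum, sum_range_succ, ← card_involutions_av3412_av4321_succ_eq_sum, ih,
      pow_succ, mul_two]

/-- `|I_n(3412, 4321)| = 2^{n−1}` for `n ≥ 1`, as printed. [cite: BarnabeiBonettiSilimbani2011, Theorem 8 (v) (arXiv 0812.0463)] -/
theorem card_involutions_av3412_av4321_pos {n : ℕ} (hn : 1 ≤ n) :
    Nat.card {u : Perm (Fin n) // u * u = 1 ∧ ¬ PermContainsPattern u ![3, 4, 1, 2] ∧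
      ¬ PermContainsPattern u ![4, 3, 2, 1]} = 2 ^ (n - 1) := by
  obtain ⟨m, rfl⟩ := Nat.exists_eq_add_of_le' hn
  rw [card_involutions_av3412_av4321, Nat.add_sub_cancel]

/-! ## Part C — COROLLARY 9 (ii): `|I_n(3412, 321)| = F_{n+1}` -/

/-! ### §1 THEOREM 8 (ii) on arcs: every arc joins two neighbours -/

/-- ★ **THEOREM 8 (ii) (Barnabei–Bonetti–Silimbani) on arcs.** An involution avoids both `3412` and `321` iff each of
its arcs joins two consecutive letters («the irreducible components of `M` are either `H` or `UD`»): its arcs neither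
cross nor nest nor cover a fixed point, so the letter after an opener can only be its partner.
[cite: BarnabeiBonettiSilimbani2011, Theorem 8 (ii) (arXiv 0812.0463)] -/
theorem not_contains_3412_321_iff_adjacent {u : Perm (Fin n)} (hu : ∀ x, u (u x) = x) :
    (¬ PermContainsPattern u ![3, 4, 1, 2] ∧ ¬ PermContainsPattern u ![3, 2, 1]) ↔
      ∀ i : Fin n, i < u i → ((u i : ℕ)) = i + 1 := by
  constructor
  · rintro ⟨h3412, h321⟩
    have hsep := (not_contains_3412_4321_iff_separated hu).1 ⟨h3412, not_contains_4321_of_not_contains_321 hu h321⟩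
    have hcov := ((not_contains_321_iff_nonnesting hu).1 h321).2
    intro i hi
    by_contra hne
    have hlt : (i : ℕ) + 1 < (u i : ℕ) := by have := Fin.lt_def.1 hi; omega
    -- the letter `i + 1` lies strictly inside the arc `(i, u i)`
    set f : Fin n := ⟨(i : ℕ) + 1, by omega⟩ with hf
    have hif : i < f := Fin.lt_def.2 (by simp [hf])
    have hfu : f < u i := Fin.lt_def.2 (by simpa [hf] using hlt)
    rcases lt_trichotomy f (u f) with hopen | hfix | hclose
    · -- `f` opens an arc: separated from `(i, u i)` forces `u i < f`
      exact absurd (hsep i f hif hi hopen) (not_lt.2 hfu.le)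
    · exact hcov i f hif hfu hfix.symm
    · -- `f` closes an arc opened at `k = u f < i`: then `(k, f)` and `(i, u i)` are not separated
      have hk : u f < u (u f) := by rw [hu]; exact hclose
      have hki : u f < i := by
        refine lt_of_le_of_ne (Nat.lt_succ_iff.1 (by simpa [hf] using Fin.lt_def.1 hclose)) fun e => ?_
        have : u i = f := by rw [← e, hu]
        exact absurd (this ▸ hfu) (lt_irrefl _)
      have := hsep (u f) i hki hk hi
      rw [hu] at this
      exact absurd this (not_lt.2 hif.le)
  · intro hadj
    have key : ∀ i j : Fin n, i < j → j < u i → False := fun i j hij hj => by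
      have := hadj i (hij.trans hj)
      have h1 := Fin.lt_def.1 hij
      have h2 := Fin.lt_def.1 hj
      omega
    refine ⟨(not_contains_3412_iff_noncrossing hu).2 fun i j hij hj _ => key i j hij hj,
      (not_contains_321_iff_nonnesting hu).2 ⟨fun i j hij hj hji => key i j hij (hj.trans hji),
        fun i f hif hfu _ => key i f hif hfu⟩⟩

/-! ### §2 The fibres over the partner of the last letter: fixed, or joined to its predecessor -/

/-- The involutions of `I_{k+1}(3412, 321)` fixing the last letter are the `τ ⊕ 1`, `τ ∈ I_k(3412, 321)`.
[cite: BarnabeiBonettiSilimbani2011, Theorem 8 (ii) and Corollary 9 (ii) (arXiv 0812.0463)] -/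
theorem card_involutions_av3412_av321_lastFixed (k : ℕ) :
    Nat.card {u : Perm (Fin (k + 1)) // (u * u = 1 ∧ ¬ PermContainsPattern u ![3, 4, 1, 2] ∧
        ¬ PermContainsPattern u ![3, 2, 1]) ∧ ((u (Fin.last k) : ℕ)) = k} =
      Nat.card {τ : Perm (Fin k) // τ * τ = 1 ∧ ¬ PermContainsPattern τ ![3, 4, 1, 2] ∧
        ¬ PermContainsPattern τ ![3, 2, 1]} := by
  refine (Nat.card_congr (Equiv.ofBijective (fun τ : {τ : Perm (Fin k) // τ * τ = 1 ∧
      ¬ PermContainsPattern τ ![3, 4, 1, 2] ∧ ¬ PermContainsPattern τ ![3, 2, 1]} =>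
    (⟨finSumFinEquiv.symm.trans ((τ.1.sumCongr (1 : Perm (Fin 1))).trans finSumFinEquiv),
      ⟨(directSum_mul_self_eq_one_iff τ.1 1).2 ⟨τ.2.1, mul_one 1⟩,
        fun h => ((contains_3412_directSum_iff τ.1 1).1 h).elim τ.2.2.1 (not_contains_of_lt _ _ (by norm_num)),
        fun h => ((contains_321_directSum_iff τ.1 1).1 h).elim τ.2.2.2 (not_contains_of_lt _ _ (by norm_num))⟩,
      by rw [directSum_one_apply_last, Fin.val_last]⟩ :
    {u : Perm (Fin (k + 1)) // (u * u = 1 ∧ ¬ PermContainsPattern u ![3, 4, 1, 2] ∧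
      ¬ PermContainsPattern u ![3, 2, 1]) ∧ ((u (Fin.last k) : ℕ)) = k})) ⟨?_, ?_⟩)).symm
  · rintro ⟨τ, hτ⟩ ⟨τ', hτ'⟩ h
    have h2 := Prod.ext_iff.mp (directSum_injective k 1 (a₁ := (τ, 1)) (a₂ := (τ', 1)) (congrArg Subtype.val h))
    exact Subtype.ext h2.1
  · rintro ⟨u, ⟨hinv, h3412, h321⟩, hlast⟩
    have hl : u (Fin.last k) = Fin.last k := Fin.ext (by rw [hlast, Fin.val_last])
    have hlow : ∀ i : Fin k, ((u (Fin.castAdd 1 i)) : ℕ) < k := by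
      intro i
      have hne : u (Fin.castAdd 1 i) ≠ Fin.last k := fun e => by
        have := congrArg Fin.val (u.injective (e.trans hl.symm))
        simp only [Fin.val_castAdd, Fin.val_last] at this
        omega
      exact lt_of_le_of_ne (Nat.lt_succ_iff.1 (u _).2) (fun e => hne (Fin.ext (by simpa using e)))
    obtain ⟨τ, ε, hρ⟩ := exists_eq_directSum u hlow
    obtain rfl : ε = 1 := Subsingleton.elim _ _
    subst hρ
    exact ⟨⟨τ, ((directSum_mul_self_eq_one_iff τ 1).1 hinv).1,
      fun h => h3412 ((contains_3412_directSum_iff τ 1).2 (Or.inl h)),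
      fun h => h321 ((contains_321_directSum_iff τ 1).2 (Or.inl h))⟩, rfl⟩

/-- ★ The involutions of `I_{k+2}(3412, 321)` whose last letter is joined to its predecessor are the `τ ⊕ (0 1)`,
`τ ∈ I_k(3412, 321)`. [cite: BarnabeiBonettiSilimbani2011, Theorem 8 (ii) and Corollary 9 (ii) (arXiv 0812.0463)] -/
theorem card_involutions_av3412_av321_lastAdjacent (k : ℕ) :
    Nat.card {u : Perm (Fin (k + 2)) // (u * u = 1 ∧ ¬ PermContainsPattern u ![3, 4, 1, 2] ∧
        ¬ PermContainsPattern u ![3, 2, 1]) ∧ ((u (Fin.last (k + 1)) : ℕ)) = k} =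
      Nat.card {τ : Perm (Fin k) // τ * τ = 1 ∧ ¬ PermContainsPattern τ ![3, 4, 1, 2] ∧
        ¬ PermContainsPattern τ ![3, 2, 1]} := by
  have hs : Equiv.swap (0 : Fin 2) 1 * Equiv.swap (0 : Fin 2) 1 = 1 := Equiv.swap_mul_self _ _
  have hs4 : ¬ PermContainsPattern (Equiv.swap (0 : Fin 2) 1) ![3, 4, 1, 2] := not_contains_of_lt _ _ (by norm_num)
  have hs3 : ¬ PermContainsPattern (Equiv.swap (0 : Fin 2) 1) ![3, 2, 1] := not_contains_of_lt _ _ (by norm_num)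
  have hlast2 : (Fin.last (k + 1) : Fin (k + 2)) = Fin.natAdd k (1 : Fin 2) := Fin.ext (by simp)
  refine (Nat.card_congr (Equiv.ofBijective (fun τ : {τ : Perm (Fin k) // τ * τ = 1 ∧
      ¬ PermContainsPattern τ ![3, 4, 1, 2] ∧ ¬ PermContainsPattern τ ![3, 2, 1]} =>
    (⟨finSumFinEquiv.symm.trans ((τ.1.sumCongr (Equiv.swap (0 : Fin 2) 1)).trans finSumFinEquiv),
      ⟨(directSum_mul_self_eq_one_iff τ.1 _).2 ⟨τ.2.1, hs⟩,
        fun h => ((contains_3412_directSum_iff τ.1 _).1 h).elim τ.2.2.1 hs4,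
        fun h => ((contains_321_directSum_iff τ.1 _).1 h).elim τ.2.2.2 hs3⟩,
      by rw [hlast2, directSum_apply_natAdd, Equiv.swap_apply_right, Fin.val_natAdd, Fin.val_zero, add_zero]⟩ :
    {u : Perm (Fin (k + 2)) // (u * u = 1 ∧ ¬ PermContainsPattern u ![3, 4, 1, 2] ∧
      ¬ PermContainsPattern u ![3, 2, 1]) ∧ ((u (Fin.last (k + 1)) : ℕ)) = k})) ⟨?_, ?_⟩)).symm
  · rintro ⟨τ, hτ⟩ ⟨τ', hτ'⟩ h
    have h2 := Prod.ext_iff.mp (directSum_injective k 2 (a₁ := (τ, Equiv.swap (0 : Fin 2) 1))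
      (a₂ := (τ', Equiv.swap (0 : Fin 2) 1)) (congrArg Subtype.val h))
    exact Subtype.ext h2.1
  · rintro ⟨u, ⟨hinv, h3412, h321⟩, hlast⟩
    have hu : ∀ x, u (u x) = x := (mul_self_eq_one_iff_apply_apply u).1 hinv
    have hl : u (Fin.natAdd k (1 : Fin 2)) = Fin.natAdd k 0 := by
      rw [← hlast2]; exact Fin.ext (by rw [hlast]; simp)
    have hl' : u (Fin.natAdd k 0) = Fin.natAdd k (1 : Fin 2) := by rw [← hl, hu]
    have hlow : ∀ i : Fin k, ((u (Fin.castAdd 2 i)) : ℕ) < k := by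
      intro i
      have hne1 : u (Fin.castAdd 2 i) ≠ Fin.natAdd k 0 := fun e => by
        have := congrArg Fin.val (u.injective (e.trans hl.symm))
        simp only [Fin.val_castAdd, Fin.val_natAdd] at this
        omega
      have hne2 : u (Fin.castAdd 2 i) ≠ Fin.natAdd k (1 : Fin 2) := fun e => by
        have := congrArg Fin.val (u.injective (e.trans hl'.symm))
        simp only [Fin.val_castAdd, Fin.val_natAdd] at this
        omega
      have hv1 : ((u (Fin.castAdd 2 i)) : ℕ) ≠ k := fun e => hne1 (Fin.ext (by rw [e]; simp))
      have hv2 : ((u (Fin.castAdd 2 i)) : ℕ) ≠ k + 1 := fun e => hne2 (Fin.ext (by rw [e]; simp))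
      have := (u (Fin.castAdd 2 i)).2
      omega
    obtain ⟨τ, ρ, hσ⟩ := exists_eq_directSum u hlow
    have hρ1 : ρ 1 = 0 := by
      have := hl
      rw [hσ, directSum_apply_natAdd] at this
      exact Fin.natAdd_injective _ _ this
    have hρ : ρ = Equiv.swap (0 : Fin 2) 1 := by
      have hρ0 : ρ 0 = 1 := by
        have hne : ρ 0 ≠ 0 := fun e => absurd (ρ.injective (e.trans hρ1.symm)) (by decide)
        exact Fin.ext (by have := (ρ 0).2; have h' : (ρ 0 : ℕ) ≠ 0 := fun e => hne (Fin.ext e); omega)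
      refine Equiv.ext fun x => ?_
      fin_cases x
      · simpa using hρ0
      · simpa using hρ1
    subst hσ
    subst hρ
    exact ⟨⟨τ, ((directSum_mul_self_eq_one_iff τ _).1 hinv).1,
      fun h => h3412 ((contains_3412_directSum_iff τ _).2 (Or.inl h)),
      fun h => h321 ((contains_321_directSum_iff τ _).2 (Or.inl h))⟩, rfl⟩

/-- In `I_{k+2}(3412, 321)` the last letter is fixed or joined to its predecessor: the fibres over the other letters
are empty. [cite: BarnabeiBonettiSilimbani2011, Theorem 8 (ii) (arXiv 0812.0463)] -/
theorem card_involutions_av3412_av321_lastFar (k : ℕ) (j : Fin k) :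
    Nat.card {u : Perm (Fin (k + 2)) // (u * u = 1 ∧ ¬ PermContainsPattern u ![3, 4, 1, 2] ∧
        ¬ PermContainsPattern u ![3, 2, 1]) ∧ ((u (Fin.last (k + 1)) : ℕ)) = j} = 0 := by
  rw [Nat.card_eq_zero]
  left
  refine ⟨fun ⟨u, ⟨hinv, h3412, h321⟩, hlast⟩ => ?_⟩
  have hu : ∀ x, u (u x) = x := (mul_self_eq_one_iff_apply_apply u).1 hinv
  have hadj := (not_contains_3412_321_iff_adjacent hu).1 ⟨h3412, h321⟩
  have hopen : u (Fin.last (k + 1)) < u (u (Fin.last (k + 1))) := by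
    rw [hu]
    exact Fin.lt_def.2 (by rw [hlast, Fin.val_last]; omega)
  have := hadj _ hopen
  rw [hu, Fin.val_last, hlast] at this
  omega

/-! ### §3 The Fibonacci recurrence and `|I_n(3412, 321)| = F_{n+1}` -/

/-- ★★ **The Fibonacci recurrence**: `|I_{k+2}(3412, 321)| = |I_{k+1}(3412, 321)| + |I_k(3412, 321)|` (last letter
fixed, or exchanged with its predecessor). [cite: BarnabeiBonettiSilimbani2011, Corollary 9 (ii) (arXiv 0812.0463)] -/
theorem card_involutions_av3412_av321_add_two (k : ℕ) :
    Nat.card {u : Perm (Fin (k + 2)) // u * u = 1 ∧ ¬ PermContainsPattern u ![3, 4, 1, 2] ∧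
        ¬ PermContainsPattern u ![3, 2, 1]} =
      Nat.card {u : Perm (Fin (k + 1)) // u * u = 1 ∧ ¬ PermContainsPattern u ![3, 4, 1, 2] ∧
          ¬ PermContainsPattern u ![3, 2, 1]} +
        Nat.card {u : Perm (Fin k) // u * u = 1 ∧ ¬ PermContainsPattern u ![3, 4, 1, 2] ∧
          ¬ PermContainsPattern u ![3, 2, 1]} := by
  rw [card_subtype_eq_sum_fiber' (fun u : Perm (Fin (k + 2)) => u * u = 1 ∧ ¬ PermContainsPattern u ![3, 4, 1, 2] ∧
      ¬ PermContainsPattern u ![3, 2, 1]) (fun u => u (Fin.last (k + 1))), Fin.sum_univ_castSucc, Fin.sum_univ_castSucc,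
    Finset.sum_eq_zero fun j _ => ?_, zero_add, add_comm]
  · congr 1
    · rw [← card_involutions_av3412_av321_lastFixed (k + 1)]
      refine Nat.card_congr (Equiv.subtypeEquivRight fun u => and_congr_right fun _ => ?_)
      rw [Fin.ext_iff, Fin.val_last]
    · rw [← card_involutions_av3412_av321_lastAdjacent k]
      refine Nat.card_congr (Equiv.subtypeEquivRight fun u => and_congr_right fun _ => ?_)
      rw [Fin.ext_iff, Fin.val_castSucc, Fin.val_last]
  · refine Eq.trans (Nat.card_congr (Equiv.subtypeEquivRight fun u => and_congr_right fun _ => ?_))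
      (card_involutions_av3412_av321_lastFar k j)
    rw [Fin.ext_iff, Fin.val_castSucc, Fin.val_castSucc]

/-- `|I_0(3412, 321)| = 1`. [cite: BarnabeiBonettiSilimbani2011, Corollary 9 (ii) (arXiv 0812.0463)] -/
theorem card_involutions_av3412_av321_zero :
    Nat.card {u : Perm (Fin 0) // u * u = 1 ∧ ¬ PermContainsPattern u ![3, 4, 1, 2] ∧
      ¬ PermContainsPattern u ![3, 2, 1]} = 1 := by
  have : Unique {u : Perm (Fin 0) // u * u = 1 ∧ ¬ PermContainsPattern u ![3, 4, 1, 2] ∧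
      ¬ PermContainsPattern u ![3, 2, 1]} :=
    { default := ⟨1, by simp, not_contains_of_lt _ _ (by norm_num), not_contains_of_lt _ _ (by norm_num)⟩
      uniq := fun u => Subtype.ext (Equiv.ext fun x => Fin.elim0 x) }
  exact Nat.card_unique

/-- `|I_1(3412, 321)| = 1`. [cite: BarnabeiBonettiSilimbani2011, Corollary 9 (ii) (arXiv 0812.0463)] -/
theorem card_involutions_av3412_av321_one :
    Nat.card {u : Perm (Fin 1) // u * u = 1 ∧ ¬ PermContainsPattern u ![3, 4, 1, 2] ∧
      ¬ PermContainsPattern u ![3, 2, 1]} = 1 := by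
  have : Unique {u : Perm (Fin 1) // u * u = 1 ∧ ¬ PermContainsPattern u ![3, 4, 1, 2] ∧
      ¬ PermContainsPattern u ![3, 2, 1]} :=
    { default := ⟨1, by simp, not_contains_of_lt _ _ (by norm_num), not_contains_of_lt _ _ (by norm_num)⟩
      uniq := fun u => Subtype.ext (Subsingleton.elim _ _) }
  exact Nat.card_unique

/-- ★★★ **COROLLARY 9 (ii) (Barnabei–Bonetti–Silimbani): `|I_n(3412, 321)| = F_{n+1}`** (Fibonacci numbers,
`F_1 = F_2 = 1`; Mathlib's `Nat.fib`): the involutions all of whose arcs join neighbours are the monomer–dimer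
tilings of a row of `n` cells. [cite: BarnabeiBonettiSilimbani2011, Corollary 9 (ii) (arXiv 0812.0463)] -/
theorem card_involutions_av3412_av321 (n : ℕ) :
    Nat.card {u : Perm (Fin n) // u * u = 1 ∧ ¬ PermContainsPattern u ![3, 4, 1, 2] ∧
      ¬ PermContainsPattern u ![3, 2, 1]} = Nat.fib (n + 1) := by
  -- two-step induction
  suffices h : Nat.card {u : Perm (Fin n) // u * u = 1 ∧ ¬ PermContainsPattern u ![3, 4, 1, 2] ∧
      ¬ PermContainsPattern u ![3, 2, 1]} = Nat.fib (n + 1) ∧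
      Nat.card {u : Perm (Fin (n + 1)) // u * u = 1 ∧ ¬ PermContainsPattern u ![3, 4, 1, 2] ∧
        ¬ PermContainsPattern u ![3, 2, 1]} = Nat.fib (n + 2) from h.1
  induction n with
  | zero => exact ⟨card_involutions_av3412_av321_zero, card_involutions_av3412_av321_one⟩
  | succ n ih =>
    exact ⟨ih.2, by rw [card_involutions_av3412_av321_add_two, ih.1, ih.2, Nat.fib_add_two (n := n + 1), add_comm]⟩

/-- The adjacent-transposition involutions of `[n]` number `F_{n+1}`.
[cite: BarnabeiBonettiSilimbani2011, Theorem 8 (ii) and Corollary 9 (ii) (arXiv 0812.0463)] -/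
theorem card_adjacent_involutions (n : ℕ) :
    Nat.card {u : Perm (Fin n) // u * u = 1 ∧ ∀ i : Fin n, i < u i → ((u i : ℕ)) = i + 1} = Nat.fib (n + 1) := by
  rw [← card_involutions_av3412_av321 n]
  exact Nat.card_congr (Equiv.subtypeEquivRight fun u => and_congr_right fun hinv =>
    (not_contains_3412_321_iff_adjacent ((mul_self_eq_one_iff_apply_apply u).1 hinv)).symm)

/-- `|I_5(3412, 321)| = 8 = F_6`. [cite: BarnabeiBonettiSilimbani2011, Corollary 9 (ii) (arXiv 0812.0463)] -/
theorem card_involutions_av3412_av321_five :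
    Nat.card {u : Perm (Fin 5) // u * u = 1 ∧ ¬ PermContainsPattern u ![3, 4, 1, 2] ∧
      ¬ PermContainsPattern u ![3, 2, 1]} = 8 := by
  rw [card_involutions_av3412_av321]
  rfl

end PermContainsPattern

end Literature.Combinatorics.Enumerative
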